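import Literature.AlgebraicGeometry.Deformation.MorphismLiftsSquareZeroOverlap
import Literature.AlgebraicGeometry.Deformation.MorphismLiftsSquareZeroAffineFunctorial
import Literature.AlgebraicGeometry.Deformation.MorphismLiftsSquareZeroGlue
import HarnessLib

/-!
# The global layer of SGA 1 III Prop. 5.1: coboundary correction of local lifts, the action of a compatible family
# of chart derivations on a global lift, and the difference family of two global lifts

Layer `Literature/AlgebraicGeometry/Deformation`, namespace `Literature.AlgebraicGeometry.Deformation`.
THEOREMS ONLY (no definition, no named fact, no instance).  Sixth file of the DEF-MOR chain (★ (ii)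
`MorphismLiftsSquareZeroAffine` — the affine torsor; ★ (v) `…AffineFunctorial` — its naturality; ★ (iv)-sheaf
`…Glue` — chartwise equality and gluing of compatible local lifts; ★ (iv)-overlap `…Overlap` — restriction of the
torsor to a smaller affine open of the target; ★ `…SmoothAffine` — local lifts exist for a smooth target).

[SGA1, Exp. III §5 Prop. 5.1 and p. 71]: the extensions of `g₀ : Y₀ → X` to `S`-morphisms on opens of the square-zero
thickening `Y` form a sheaf `𝒫(g₀)`, formally principal homogeneous under `𝒢 = 𝓗om(g₀^*Ω¹_{X/S}, 𝒥)`; hence «l'ensemble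
des prolongements globaux est un espace principal homogène sous `H⁰(Y, 𝒢)`» as soon as it is non-empty, and the
obstruction to its non-emptiness is the class in `H¹(Y, 𝒢)` of the Čech 1-cocycle «difference of two local
extensions on the overlaps».  This file records that GLOBAL layer at scheme level, def-free, in the CHART currency of
the chain (affine base `S = Spec R₀`; the thickening `i : Z₀ → Z` covered by affine charts `e α : Spec (B α) → Z`,
`e₀ α : Spec (B₀ α) → Z₀` with `e₀ α ≫ i = Spec (π α) ≫ e α`, `π α : B α → B₀ α`, `(ker π α)² = 0`; local lifts
`g α : Spec (B α) → X` of `e₀ α ≫ f₀` through affine opens `V α` of the target; derivations read on charts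
`ψ_V(g) = g.appLE V ⊤ ≫ ΓSpecIso`), i.e. exactly the two items listed as «NOT here» in ★ `MorphismLiftsSquareZeroGlue`:

* §1 ONE CHART AT A TIME (ring level, as ★ `SmoothSchemeLiftObstructionCocycle` does for the 2-cocycle): the
  difference functions of `S`-lifts through one affine `V` are ADDITIVE in the pair (`charts_eq_add_add_of_charts_eq_add`
  — the 1-cocycle identity `δ(s,u) = δ(s,t) + δ(t,u)`), antisymmetric (`charts_eq_add_neg_of_charts_eq_add`), and
  correcting both lifts by `ε`, `ε′` changes the difference by the coboundary `ε′ − ε`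
  (`charts_eq_add_coboundary`);
* §2 **COBOUNDARY CORRECTION ⇒ GLOBAL LIFT** (`exists_lift_of_coboundary`, the head): local `S`-lifts `g α` of `f₀`
  on an affine cover of `Z`, and `R₀`-derivations `ε α : Γ(X, V α) → ker (π α)` such that ON EVERY AFFINE TEST CHART
  `t : Spec C → U_α ∩ U_β` (through ring maps `u_α : B α → C`, `u_β : B β → C`, both pulled-back lifts landing in a
  common affine `V′ ≤ V α ⊓ V β` that is a localisation of both) ONE `R₀`-derivation `D′` on `Γ(X, V′)` restricts to
  `u_α ∘ ε α` on `Γ(X, V α)` and to `(ψ_{V β}(u_β^* g β) − ψ_{V β}(u_α^* g α)) + u_β ∘ ε β` on `Γ(X, V β)` — the chart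
  form of «the 1-cocycle `δ_{αβ} = g β − g α` is the coboundary `ε α − ε β`» — then the corrected local lifts
  `g α + ε α` (★ `exists_lift_of_derivation`) agree on the overlaps (★ `eq_of_derivations_restrict` on the test
  charts, ★ `eq_of_forall_exists_chart_eq`) and glue (★ `existsUnique_glue_of_lifts`) to a global `S`-morphism
  `G : Z → X` with `i ≫ G = f₀` whose `α`-charts are `ψ(g α) + ε α`;
* §3 **THE ACTION OF A COMPATIBLE FAMILY ON A GLOBAL LIFT** (`exists_lift_of_compatible_family`): the case
  `g α = e α ≫ G` of §2 — a family `ε α` compatible on the test charts (one `D′` restricting to `u_α ∘ ε α` and to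
  `u_β ∘ ε β`) moves a global lift `G` to a global lift `G′` with charts `ψ(e α ≫ G) + ε α`; and a global lift is
  determined by its charts (`eq_of_charts_eq_of_cover`);
* §4 **THE DIFFERENCE FAMILY OF TWO GLOBAL LIFTS** (`exists_derivation_of_lifts_of_cover`,
  `exists_restrict_of_lifts_of_cover`): two global `S`-lifts `G₁, G₂` of `f₀` differ on each chart by a unique
  derivation `ε α` (★ (ii)), and this family IS compatible on every test chart (★ (ii) in `V′` + ★ (v) change of
  source + ★ `chart_map_apply`): together with §3, the global lifts form a principal homogeneous space under the
  compatible families — «sous `H⁰(Y, 𝒢)`».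

What is NOT here: the identification `Der_{R₀}(Γ(X, V), ker π) = Hom(g₀^*Ω¹_{X/S}, 𝒥)(U)` with a quasi-coherent sheaf
`𝒢` on `Z₀` and the resulting class in sheaf cohomology `H¹(Z₀, 𝒢)` (consumers with a FREE `Ω¹_{X/S}` — abelian
schemes, [MumfordFogartyKirwan1994, Prop. 6.15] — read the coboundary hypothesis of §2 in `𝒥^{⊕ r}` directly).

Cell hodgecm-mathlib (D-0151), F-11 row A4b LACK-1 (B-p04 (g21) census `CENSUS-F11-A4b-AbelianSchemeOfLiftedSection`;
B-plan1 (g18) U34 (b) GO HOME-only); count-neutral generic capital.  HC_CM is proved only modulo the 7 printed citations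
until rung 0 closes; this file discharges none of them.

## References
* [SGA1] A. Grothendieck, M. Raynaud, *Revêtements étales et groupe fondamental (SGA 1)*, LNM 224 / arXiv:math/0206203:
  Exp. III §5 Prop. 5.1 and the paragraph after it (arXiv ed. p. 71, held `paper:arxiv-math_0206203` p0049–p0050:
  «l'ensemble des prolongements globaux est un espace principal homogène sous `H⁰(Y, 𝒢)`», obstruction in `H¹(Y, 𝒢)`).
* [MumfordFogartyKirwan1994] D. Mumford, J. Fogarty, F. Kirwan, *Geometric Invariant Theory*, 3rd ed. (1994), Ch. 6 §3
  Prop. 6.15 (pp. 124–125): the consumer («the obstruction to extending `μ₀` is an element `β ∈ H¹(X̄ × X̄, μ̄^*𝒯 ⊗ I)`»;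
  «the set of all extensions is a principal homogeneous space under `H⁰`»).
-/

universe u

open CategoryTheory CategoryTheory.Limits AlgebraicGeometry

noncomputable section

namespace Literature.AlgebraicGeometry.Deformation

/-! ### §1 One chart at a time: the difference functions form a 1-cocycle and change by coboundaries -/

section OneChart

variable {X : Scheme.{u}} {V : X.Opens} {C : Type u} [CommRing C]

/-- **Charts of equal morphisms agree**: the chart `ψ_V(m) = m.appLE V ⊤ _ ≫ ΓSpecIso` does not depend on the proof
that `m` lands in `V`, so `m₁ = m₂` gives `ψ_V(m₁) = ψ_V(m₂)` (used to transport charts along the equalities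
`t ≫ fst = Spec u_α`, `Spec u_α ≫ e α = Spec u_β ≫ e β` of the test charts). [cite: SGA1, Exp. III §5 Prop. 5.1] -/
theorem chart_congr {m₁ m₂ : Spec (.of C) ⟶ X} (hm : m₁ = m₂) (h₁ : m₁ ⁻¹ᵁ V = ⊤) (h₂ : m₂ ⁻¹ᵁ V = ⊤) :
    m₁.appLE V ⊤ h₁.ge ≫ (Scheme.ΓSpecIso (.of C)).hom = m₂.appLE V ⊤ h₂.ge ≫ (Scheme.ΓSpecIso (.of C)).hom := by
  subst hm; rfl

/-- **The 1-cocycle identity, one chart at a time**: for three morphisms `s t u : Spec C → X` through the affine open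
`V`, if `ψ_V(t) = ψ_V(s) + δ₁` and `ψ_V(u) = ψ_V(t) + δ₂` then `ψ_V(u) = ψ_V(s) + (δ₁ + δ₂)` — the difference of local
lifts is additive in the pair (`δ(s,u) = δ(s,t) + δ(t,u)`), which on a triple overlap is the cocycle condition of
«la différence de deux prolongements locaux». [cite: SGA1, Exp. III §5 Prop. 5.1] -/
theorem charts_eq_add_add_of_charts_eq_add {s t u : Spec (.of C) ⟶ X} (hs : s ⁻¹ᵁ V = ⊤) (ht : t ⁻¹ᵁ V = ⊤)
    (hu : u ⁻¹ᵁ V = ⊤) {δ₁ δ₂ : Γ(X, V) → C}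
    (h₁ : ∀ a, (t.appLE V ⊤ ht.ge ≫ (Scheme.ΓSpecIso (.of C)).hom).hom a =
      (s.appLE V ⊤ hs.ge ≫ (Scheme.ΓSpecIso (.of C)).hom).hom a + δ₁ a)
    (h₂ : ∀ a, (u.appLE V ⊤ hu.ge ≫ (Scheme.ΓSpecIso (.of C)).hom).hom a =
      (t.appLE V ⊤ ht.ge ≫ (Scheme.ΓSpecIso (.of C)).hom).hom a + δ₂ a) (a : Γ(X, V)) :
    (u.appLE V ⊤ hu.ge ≫ (Scheme.ΓSpecIso (.of C)).hom).hom a =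
      (s.appLE V ⊤ hs.ge ≫ (Scheme.ΓSpecIso (.of C)).hom).hom a + (δ₁ a + δ₂ a) := by
  rw [h₂ a, h₁ a, add_assoc]

/-- **Antisymmetry of the difference**: if `ψ_V(t) = ψ_V(s) + δ` then `ψ_V(s) = ψ_V(t) + (-δ)` (`δ(t,s) = -δ(s,t)`).
[cite: SGA1, Exp. III §5 Prop. 5.1] -/
theorem charts_eq_add_neg_of_charts_eq_add {s t : Spec (.of C) ⟶ X} (hs : s ⁻¹ᵁ V = ⊤) (ht : t ⁻¹ᵁ V = ⊤)
    {δ : Γ(X, V) → C}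
    (h : ∀ a, (t.appLE V ⊤ ht.ge ≫ (Scheme.ΓSpecIso (.of C)).hom).hom a =
      (s.appLE V ⊤ hs.ge ≫ (Scheme.ΓSpecIso (.of C)).hom).hom a + δ a) (a : Γ(X, V)) :
    (s.appLE V ⊤ hs.ge ≫ (Scheme.ΓSpecIso (.of C)).hom).hom a =
      (t.appLE V ⊤ ht.ge ≫ (Scheme.ΓSpecIso (.of C)).hom).hom a + (-δ a) := by
  rw [h a, add_neg_cancel_right]

/-- **Correcting both lifts changes their difference by a coboundary**: if `ψ(t) = ψ(s) + δ` (the cocycle of the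
pair `(s, t)`), `ψ(s′) = ψ(s) + ε` and `ψ(t′) = ψ(t) + ε′` (the corrected lifts), then `ψ(t′) = ψ(s′) + (δ + ε′ - ε)` —
«le cocycle change par un cobord». [cite: SGA1, Exp. III §5 Prop. 5.1] -/
theorem charts_eq_add_coboundary {s t s' t' : Spec (.of C) ⟶ X} (hs : s ⁻¹ᵁ V = ⊤) (ht : t ⁻¹ᵁ V = ⊤)
    (hs' : s' ⁻¹ᵁ V = ⊤) (ht' : t' ⁻¹ᵁ V = ⊤) {δ ε ε' : Γ(X, V) → C}
    (hδ : ∀ a, (t.appLE V ⊤ ht.ge ≫ (Scheme.ΓSpecIso (.of C)).hom).hom a =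
      (s.appLE V ⊤ hs.ge ≫ (Scheme.ΓSpecIso (.of C)).hom).hom a + δ a)
    (hε : ∀ a, (s'.appLE V ⊤ hs'.ge ≫ (Scheme.ΓSpecIso (.of C)).hom).hom a =
      (s.appLE V ⊤ hs.ge ≫ (Scheme.ΓSpecIso (.of C)).hom).hom a + ε a)
    (hε' : ∀ a, (t'.appLE V ⊤ ht'.ge ≫ (Scheme.ΓSpecIso (.of C)).hom).hom a =
      (t.appLE V ⊤ ht.ge ≫ (Scheme.ΓSpecIso (.of C)).hom).hom a + ε' a) (a : Γ(X, V)) :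
    (t'.appLE V ⊤ ht'.ge ≫ (Scheme.ΓSpecIso (.of C)).hom).hom a =
      (s'.appLE V ⊤ hs'.ge ≫ (Scheme.ΓSpecIso (.of C)).hom).hom a + (δ a + ε' a - ε a) := by
  rw [hε' a, hδ a, hε a]; abel

end OneChart

/-! ### §2 Coboundary correction of local lifts: «class = 0 ⇒ a global lift exists» -/

section Coboundary

variable {X Z Z₀ : Scheme.{u}} {R₀ : Type u} [CommRing R₀] (p : X ⟶ Spec (.of R₀)) (q : Z ⟶ Spec (.of R₀))
  (i : Z₀ ⟶ Z) (f₀ : Z₀ ⟶ X)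
  {ι : Type u} {B B₀ : ι → Type u} [∀ α, CommRing (B α)] [∀ α, CommRing (B₀ α)] [∀ α, Algebra R₀ (B α)]
  (π : ∀ α, B α →+* B₀ α)
  (e : ∀ α, Spec (.of (B α)) ⟶ Z) [∀ α, IsOpenImmersion (e α)]
  (e₀ : ∀ α, Spec (.of (B₀ α)) ⟶ Z₀) [∀ α, IsOpenImmersion (e₀ α)]
  (V : ι → X.Opens)

/-- **Coboundary correction of local lifts gives a global lift** ([SGA1, Exp. III §5 Prop. 5.1], the global layer:
«if the class of the 1-cocycle of differences of local extensions vanishes in `H¹(Y, 𝒢)`, a global extension exists»,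
read on charts).  DATA: the affine base `S = Spec R₀`; the `S`-scheme `q : Z → S` with a jointly surjective family of
affine open charts `e α : Spec (B α) → Z` over `S`; the thickening `i : Z₀ → Z`, covered by the open charts
`e₀ α : Spec (B₀ α) → Z₀` with `e₀ α ≫ i = Spec (π α) ≫ e α`, `(ker π α)² = 0`; the target `p : X → S` with affine opens
`V α`; `f₀ : Z₀ → X`; LOCAL `S`-LIFTS `g α : Spec (B α) → X` of `f₀` through `V α` (`Spec (π α) ≫ g α = e₀ α ≫ f₀`);
CORRECTIONS `ε α ∈ Der_{R₀}(Γ(X, V α), ker (π α))` (module structure through the chart of `g α`).  COBOUNDARY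
HYPOTHESIS `hcob`: every point of every overlap `Spec (B α) ×_Z Spec (B β)` lies in an affine test chart
`t : Spec C → Spec (B α) ×_Z Spec (B β)` given by `R₀`-algebra maps `u_α : B α → C`, `u_β : B β → C`
(`t ≫ fst = Spec u_α`, `t ≫ snd = Spec u_β`) with a square-zero quotient `π_C : C → C₀` on which the two pulled-back
lifts `u_α^* g α := Spec u_α ≫ g α`, `u_β^* g β` agree, both landing in an affine `V′ ≤ V α ⊓ V β` with `Γ(X, V′)` a
localisation of `Γ(X, V α)` and of `Γ(X, V β)`, and ONE `R₀`-derivation `D′ : Γ(X, V′) → ker π_C` (module structure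
through the `V′`-chart of `u_α^* g α`) with `D′(a|_{V′}) = u_α (ε α a)` for `a ∈ Γ(X, V α)` and
`D′(b|_{V′}) = (ψ_{V β}(u_β^* g β)(b) − ψ_{V β}(u_α^* g α)(b)) + u_β (ε β b)` for `b ∈ Γ(X, V β)` — i.e. the difference
cocycle `δ_{αβ}` is the coboundary `ε α − ε β` on the overlap.  CONCLUSION: there is a global `S`-morphism
`G : Z → X` extending `f₀` whose restriction to each chart lands in `V α` with chart `ψ(g α) + ε α` (the corrected
lifts, glued).  Proof: ★ `exists_lift_of_derivation` (corrected lifts) + ★ `charts_specMap_comp_of_derivation` (their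
pull-backs to the test charts) + ★ `eq_of_derivations_restrict` (agreement on the test charts) + ★
`eq_of_forall_exists_chart_eq` + ★ `existsUnique_glue_of_lifts` / `glue_over` / `glue_comp_eq`.
[cite: SGA1, Exp. III §5 Prop. 5.1] [cite: MumfordFogartyKirwan1994, Ch. 6 §3 Prop. 6.15 (pp. 124–125)] -/
theorem exists_lift_of_coboundary [∀ α, Surjective (Spec.map (CommRingCat.ofHom (π α)))]
    (he : ∀ z : Z, ∃ α, z ∈ Set.range (e α).base)
    (he₀ : ∀ z : Z₀, ∃ α, z ∈ Set.range (e₀ α).base)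
    (hq : ∀ α, e α ≫ q = Spec.map (CommRingCat.ofHom (algebraMap R₀ (B α))))
    (hi : ∀ α, e₀ α ≫ i = Spec.map (CommRingCat.ofHom (π α)) ≫ e α)
    (hπ2 : ∀ α, RingHom.ker (π α) ^ 2 = ⊥) (hV : ∀ α, IsAffineOpen (V α))
    (g : ∀ α, Spec (.of (B α)) ⟶ X) (w : ∀ α, g α ≫ p = Spec.map (CommRingCat.ofHom (algebraMap R₀ (B α))))
    (hg : ∀ α, (g α) ⁻¹ᵁ V α = ⊤) (h₀ : ∀ α, Spec.map (CommRingCat.ofHom (π α)) ≫ g α = e₀ α ≫ f₀)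
    (ε : ∀ α,
      letI : Algebra R₀ Γ(X, V α) := ((Scheme.ΓSpecIso (.of R₀)).inv ≫ p.appLE ⊤ (V α) le_top).hom.toAlgebra
      letI : Algebra Γ(X, V α) (B α) := ((g α).appLE (V α) ⊤ (hg α).ge ≫ (Scheme.ΓSpecIso (.of (B α))).hom).hom.toAlgebra
      Derivation R₀ Γ(X, V α) (RingHom.ker (π α)))
    (hcob : ∀ α β (x : ↑(pullback (e α) (e β))),
      ∃ (C C₀ : Type u) (_ : CommRing C) (_ : CommRing C₀) (_ : Algebra R₀ C) (πC : C →+* C₀)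
        (_ : RingHom.ker πC ^ 2 = ⊥) (uα : B α →ₐ[R₀] C) (uβ : B β →ₐ[R₀] C)
        (u₀α : B₀ α →+* C₀) (u₀β : B₀ β →+* C₀)
        (_ : πC.comp uα.toRingHom = u₀α.comp (π α)) (_ : πC.comp uβ.toRingHom = u₀β.comp (π β))
        (t : Spec (.of C) ⟶ pullback (e α) (e β)) (_ : IsOpenImmersion t) (_ : x ∈ Set.range t.base)
        (_ : t ≫ pullback.fst (e α) (e β) = Spec.map (CommRingCat.ofHom uα.toRingHom))
        (_ : t ≫ pullback.snd (e α) (e β) = Spec.map (CommRingCat.ofHom uβ.toRingHom))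
        (_ : Spec.map (CommRingCat.ofHom πC) ≫ (Spec.map (CommRingCat.ofHom uα.toRingHom) ≫ g α) =
          Spec.map (CommRingCat.ofHom πC) ≫ (Spec.map (CommRingCat.ofHom uβ.toRingHom) ≫ g β))
        (V' : X.Opens) (_ : IsAffineOpen V') (hα' : V' ≤ V α) (hβ' : V' ≤ V β)
        (Mα : Submonoid Γ(X, V α)) (Mβ : Submonoid Γ(X, V β))
        (_ : letI : Algebra Γ(X, V α) Γ(X, V') := (X.presheaf.map (homOfLE hα').op).hom.toAlgebra
          IsLocalization Mα Γ(X, V'))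
        (_ : letI : Algebra Γ(X, V β) Γ(X, V') := (X.presheaf.map (homOfLE hβ').op).hom.toAlgebra
          IsLocalization Mβ Γ(X, V'))
        (hsV' : (Spec.map (CommRingCat.ofHom uα.toRingHom) ≫ g α) ⁻¹ᵁ V' = ⊤)
        (hsβ : (Spec.map (CommRingCat.ofHom uα.toRingHom) ≫ g α) ⁻¹ᵁ V β = ⊤)
        (_ : (Spec.map (CommRingCat.ofHom uβ.toRingHom) ≫ g β) ⁻¹ᵁ V' = ⊤)
        (htβ : (Spec.map (CommRingCat.ofHom uβ.toRingHom) ≫ g β) ⁻¹ᵁ V β = ⊤),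
        letI : Algebra R₀ Γ(X, V') := ((Scheme.ΓSpecIso (.of R₀)).inv ≫ p.appLE ⊤ V' le_top).hom.toAlgebra
        letI : Algebra Γ(X, V') C := ((Spec.map (CommRingCat.ofHom uα.toRingHom) ≫ g α).appLE V' ⊤ hsV'.ge ≫
          (Scheme.ΓSpecIso (.of C)).hom).hom.toAlgebra
        ∃ D' : Derivation R₀ Γ(X, V') (RingHom.ker πC),
          (∀ a : Γ(X, V α), (D' (X.presheaf.map (homOfLE hα').op a) : C) = uα (ε α a)) ∧
          (∀ b : Γ(X, V β), (D' (X.presheaf.map (homOfLE hβ').op b) : C) =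
            ((Spec.map (CommRingCat.ofHom uβ.toRingHom) ≫ g β).appLE (V β) ⊤ htβ.ge ≫
                (Scheme.ΓSpecIso (.of C)).hom).hom b -
              ((Spec.map (CommRingCat.ofHom uα.toRingHom) ≫ g α).appLE (V β) ⊤ hsβ.ge ≫
                (Scheme.ΓSpecIso (.of C)).hom).hom b + uβ (ε β b))) :
    ∃ G : Z ⟶ X, G ≫ p = q ∧ i ≫ G = f₀ ∧ ∀ α, ∃ hG : (e α ≫ G) ⁻¹ᵁ V α = ⊤,
      ∀ a, ((e α ≫ G).appLE (V α) ⊤ hG.ge ≫ (Scheme.ΓSpecIso (.of (B α))).hom).hom a =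
        ((g α).appLE (V α) ⊤ (hg α).ge ≫ (Scheme.ΓSpecIso (.of (B α))).hom).hom a + (ε α a : B α) := by
  -- STEP 1: the corrected local lifts `g' α = g α + ε α` (★ (ii), action of `Der` on the affine torsor)
  have corr : ∀ α, ∃ (g' : Spec (.of (B α)) ⟶ X) (hg' : g' ⁻¹ᵁ V α = ⊤),
      g' ≫ p = Spec.map (CommRingCat.ofHom (algebraMap R₀ (B α))) ∧
      Spec.map (CommRingCat.ofHom (π α)) ≫ g α = Spec.map (CommRingCat.ofHom (π α)) ≫ g' ∧
      ∀ a, (g'.appLE (V α) ⊤ hg'.ge ≫ (Scheme.ΓSpecIso (.of (B α))).hom).hom a =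
        ((g α).appLE (V α) ⊤ (hg α).ge ≫ (Scheme.ΓSpecIso (.of (B α))).hom).hom a + (ε α a : B α) :=
    fun α => exists_lift_of_derivation p (π α) (hV α) (hπ2 α) (g α) (w α) (hg α) (ε α)
  choose g' hg' w' h₀' hchart using corr
  -- the corrected lifts have the same underlying maps as the `g α` (`Spec (π α)` is surjective)
  have hpre : ∀ γ (W : X.Opens), (g' γ) ⁻¹ᵁ W = (g γ) ⁻¹ᵁ W := fun γ W =>
    (preimage_eq_of_comp_eq (Spec.map (CommRingCat.ofHom (π γ))) (h₀' γ) W).symm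
  -- STEP 2: the corrected lifts agree on the overlaps (tested on the affine charts of `hcob`)
  have hover : ∀ α β, pullback.fst (e α) (e β) ≫ g' α = pullback.snd (e α) (e β) ≫ g' β := by
    intro α β
    refine eq_of_forall_exists_chart_eq fun x => ?_
    obtain ⟨C, C₀, _, _, _, πC, hπC2, uα, uβ, u₀α, u₀β, huα, huβ, t, ht, hx, htfst, htsnd, hagree, V', hV'a, hα',
      hβ', Mα, Mβ, hlocα, hlocβ, hsV', hsβ, htV', htβ, D', hD'α, hD'β⟩ := hcob α β x
    -- the three `S`-lifts `s := u_α^* g α`, `t₁ := u_α^* g' α`, `t₂ := u_β^* g' β : Spec C → X`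
    have ws := specMap_comp_over p uα (g α) (w α)
    have wt₁ := specMap_comp_over p uα (g' α) (w' α)
    have wt₂ := specMap_comp_over p uβ (g' β) (w' β)
    have h₁ := specMap_comp_agree (π α) πC uα u₀α huα (h₀' α)
    have h₂ : Spec.map (CommRingCat.ofHom πC) ≫ (Spec.map (CommRingCat.ofHom uα.toRingHom) ≫ g α) =
        Spec.map (CommRingCat.ofHom πC) ≫ (Spec.map (CommRingCat.ofHom uβ.toRingHom) ≫ g' β) :=
      hagree.trans (specMap_comp_agree (π β) πC uβ u₀β huβ (h₀' β))
    have hsα := preimage_specMap_comp_eq_top uα (hg α)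
    have ht₁α := preimage_specMap_comp_eq_top uα (hg' α)
    have ht₂β := preimage_specMap_comp_eq_top uβ (hg' β)
    have ht₁V' : (Spec.map (CommRingCat.ofHom uα.toRingHom) ≫ g' α) ⁻¹ᵁ V' = ⊤ := by
      rw [Scheme.Hom.comp_preimage, hpre]; rw [Scheme.Hom.comp_preimage] at hsV'; exact hsV'
    have ht₂V' : (Spec.map (CommRingCat.ofHom uβ.toRingHom) ≫ g' β) ⁻¹ᵁ V' = ⊤ := by
      rw [Scheme.Hom.comp_preimage, hpre]; rw [Scheme.Hom.comp_preimage] at htV'; exact htV'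
    -- the coboundary hypothesis in the form ★ `eq_of_derivations_restrict` consumes
    have hDα : ∀ a : Γ(X, V α), (D' (X.presheaf.map (homOfLE hα').op a) : C) =
        ((Spec.map (CommRingCat.ofHom uα.toRingHom) ≫ g' α).appLE (V α) ⊤ ht₁α.ge ≫
            (Scheme.ΓSpecIso (.of C)).hom).hom a -
          ((Spec.map (CommRingCat.ofHom uα.toRingHom) ≫ g α).appLE (V α) ⊤ hsα.ge ≫
            (Scheme.ΓSpecIso (.of C)).hom).hom a := by
      intro a
      have hc := charts_specMap_comp_of_derivation uα (hV α) (hg α) (hg' α) hsα ht₁α (hchart α) a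
      rw [hc, hD'α a]
      exact (add_sub_cancel_left _ _).symm
    have hDβ : ∀ b : Γ(X, V β), (D' (X.presheaf.map (homOfLE hβ').op b) : C) =
        ((Spec.map (CommRingCat.ofHom uβ.toRingHom) ≫ g' β).appLE (V β) ⊤ ht₂β.ge ≫
            (Scheme.ΓSpecIso (.of C)).hom).hom b -
          ((Spec.map (CommRingCat.ofHom uα.toRingHom) ≫ g α).appLE (V β) ⊤ hsβ.ge ≫
            (Scheme.ΓSpecIso (.of C)).hom).hom b := by
      intro b
      have hc := charts_specMap_comp_of_derivation uβ (hV β) (hg β) (hg' β) htβ ht₂β (hchart β) b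
      rw [hc, hD'β b]
      abel
    have e12 := eq_of_derivations_restrict p πC hV'a hα' hβ' Mα Mβ hlocα hlocβ hπC2 _ _ _ ws wt₁ wt₂ h₁ h₂
      hsα hsβ hsV' ht₁α ht₁V' ht₂β ht₂V' D' hDα hDβ
    -- read on the test chart `t`
    have efst : t ≫ (pullback.fst (e α) (e β) ≫ g' α) = Spec.map (CommRingCat.ofHom uα.toRingHom) ≫ g' α := by
      rw [← Category.assoc, htfst]
    have esnd : t ≫ (pullback.snd (e α) (e β) ≫ g' β) = Spec.map (CommRingCat.ofHom uβ.toRingHom) ≫ g' β := by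
      rw [← Category.assoc, htsnd]
    have ha : (t ≫ (pullback.fst (e α) (e β) ≫ g' α)) ⁻¹ᵁ V' = ⊤ := by rw [efst]; exact ht₁V'
    have hb : (t ≫ (pullback.snd (e α) (e β) ≫ g' β)) ⁻¹ᵁ V' = ⊤ := by rw [esnd]; exact ht₂V'
    exact ⟨C, inferInstance, t, ht, hx, V', hV'a, ha, hb, chart_congr (efst.trans (e12.trans esnd.symm)) ha hb⟩
  -- STEP 3: glue (★ (iv)-sheaf), over `S`, extending `f₀`
  let 𝒰 : Z.OpenCover := Scheme.Cover.mkOfCovers (P := @IsOpenImmersion) ι (fun α => Spec (.of (B α))) e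
    (fun z => by obtain ⟨α, y, hy⟩ := he z; exact ⟨α, y, hy⟩) (fun α => inferInstance)
  obtain ⟨G, hG, -⟩ := existsUnique_glue_of_lifts 𝒰 g' hover
  have wG : G ≫ p = q := glue_over 𝒰 g' p q hG (fun α => (w' α).trans (hq α).symm)
  let 𝒰₀ : Z₀.OpenCover := Scheme.Cover.mkOfCovers (P := @IsOpenImmersion) ι (fun α => Spec (.of (B₀ α))) e₀
    (fun z => by obtain ⟨α, y, hy⟩ := he₀ z; exact ⟨α, y, hy⟩) (fun α => inferInstance)
  have hG₀ : i ≫ G = f₀ :=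
    glue_comp_eq 𝒰 g' i f₀ 𝒰₀ id (fun α => Spec.map (CommRingCat.ofHom (π α))) (fun α => (hi α).symm) hG
      (fun α => (h₀' α).symm.trans (h₀ α))
  refine ⟨G, wG, hG₀, fun α => ?_⟩
  have hGα : e α ≫ G = g' α := hG α
  have hpreα : (e α ≫ G) ⁻¹ᵁ V α = ⊤ := by rw [hGα]; exact hg' α
  exact ⟨hpreα, fun a =>
    (congrArg (fun φ => φ.hom a) (chart_congr hGα hpreα (hg' α))).trans (hchart α a)⟩

end Coboundary

/-! ### §3 The action of a compatible family of chart derivations on a global lift (the `H⁰`-torsor, existence) -/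

section Action

variable {X Z Z₀ : Scheme.{u}} {R₀ : Type u} [CommRing R₀] (p : X ⟶ Spec (.of R₀)) (q : Z ⟶ Spec (.of R₀))
  (i : Z₀ ⟶ Z) (f₀ : Z₀ ⟶ X)
  {ι : Type u} {B B₀ : ι → Type u} [∀ α, CommRing (B α)] [∀ α, CommRing (B₀ α)] [∀ α, Algebra R₀ (B α)]
  (π : ∀ α, B α →+* B₀ α)
  (e : ∀ α, Spec (.of (B α)) ⟶ Z) [∀ α, IsOpenImmersion (e α)]
  (e₀ : ∀ α, Spec (.of (B₀ α)) ⟶ Z₀) [∀ α, IsOpenImmersion (e₀ α)]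
  (V : ι → X.Opens)

/-- **A global lift is determined by its charts**: two morphisms `G₁ G₂ : Z → X` whose restrictions to every chart
`e α : Spec (B α) → Z` of a jointly surjective family land in the affine open `V α` with the same chart there are
equal (Mathlib `Scheme.Cover.hom_ext` on the cover assembled from the `e α`, ★ `eq_of_charts_eq`) — the
`H⁰`-torsor is simply transitive. [cite: SGA1, Exp. III §5 Prop. 5.1] -/
theorem eq_of_charts_eq_of_cover (he : ∀ z : Z, ∃ α, z ∈ Set.range (e α).base) (hV : ∀ α, IsAffineOpen (V α))
    {G₁ G₂ : Z ⟶ X} (hG₁ : ∀ α, (e α ≫ G₁) ⁻¹ᵁ V α = ⊤) (hG₂ : ∀ α, (e α ≫ G₂) ⁻¹ᵁ V α = ⊤)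
    (h : ∀ α, (e α ≫ G₁).appLE (V α) ⊤ (hG₁ α).ge ≫ (Scheme.ΓSpecIso (.of (B α))).hom =
      (e α ≫ G₂).appLE (V α) ⊤ (hG₂ α).ge ≫ (Scheme.ΓSpecIso (.of (B α))).hom) :
    G₁ = G₂ := by
  let 𝒰 : Z.OpenCover := Scheme.Cover.mkOfCovers (P := @IsOpenImmersion) ι (fun α => Spec (.of (B α))) e
    (fun z => by obtain ⟨α, y, hy⟩ := he z; exact ⟨α, y, hy⟩) (fun α => inferInstance)
  exact Scheme.Cover.hom_ext 𝒰 G₁ G₂ fun α => eq_of_charts_eq (hV α) (hG₁ α) (hG₂ α) (h α)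

/-- **The action of a compatible family of chart derivations on a global lift** ([SGA1, Exp. III §5 Prop. 5.1 and
p. 71]: «l'ensemble des prolongements globaux est un espace principal homogène sous `H⁰(Y, 𝒢)`», existence of the
translate).  DATA as in ★ `exists_lift_of_coboundary`, but starting from a GLOBAL `S`-lift `G : Z → X` of `f₀`
(`G ≫ p = q`, `i ≫ G = f₀`) whose charts land in the affine opens `V α`, and a family of `R₀`-derivations
`ε α : Γ(X, V α) → ker (π α)` (module structure through the chart of `e α ≫ G`) which is COMPATIBLE on every affine
test chart `t : Spec C → Spec (B α) ×_Z Spec (B β)` (`t ≫ fst = Spec u_α`, `t ≫ snd = Spec u_β`, square-zero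
`π_C : C → C₀`, the pulled-back lift landing in an affine `V′ ≤ V α ⊓ V β` that is a localisation of both): ONE
`R₀`-derivation `D′` on `Γ(X, V′)` restricts to `u_α ∘ ε α` on `Γ(X, V α)` and to `u_β ∘ ε β` on `Γ(X, V β)` (a global
section of `𝒢` read on charts).  CONCLUSION: there is a global `S`-lift `G′` of `f₀` whose `α`-charts are
`ψ(e α ≫ G) + ε α`; it is unique by ★ `eq_of_charts_eq_of_cover`.  (The case `g α := e α ≫ G` of ★
`exists_lift_of_coboundary`: the difference cocycle of the restrictions of ONE global lift vanishes.)
[cite: SGA1, Exp. III §5 Prop. 5.1] [cite: MumfordFogartyKirwan1994, Ch. 6 §3 Prop. 6.15 (pp. 124–125)] -/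
theorem exists_lift_of_compatible_family [∀ α, Surjective (Spec.map (CommRingCat.ofHom (π α)))]
    (he : ∀ z : Z, ∃ α, z ∈ Set.range (e α).base)
    (he₀ : ∀ z : Z₀, ∃ α, z ∈ Set.range (e₀ α).base)
    (hq : ∀ α, e α ≫ q = Spec.map (CommRingCat.ofHom (algebraMap R₀ (B α))))
    (hi : ∀ α, e₀ α ≫ i = Spec.map (CommRingCat.ofHom (π α)) ≫ e α)
    (hπ2 : ∀ α, RingHom.ker (π α) ^ 2 = ⊥) (hV : ∀ α, IsAffineOpen (V α))
    (G : Z ⟶ X) (wG : G ≫ p = q) (hG₀ : i ≫ G = f₀) (hG : ∀ α, (e α ≫ G) ⁻¹ᵁ V α = ⊤)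
    (ε : ∀ α,
      letI : Algebra R₀ Γ(X, V α) := ((Scheme.ΓSpecIso (.of R₀)).inv ≫ p.appLE ⊤ (V α) le_top).hom.toAlgebra
      letI : Algebra Γ(X, V α) (B α) :=
        ((e α ≫ G).appLE (V α) ⊤ (hG α).ge ≫ (Scheme.ΓSpecIso (.of (B α))).hom).hom.toAlgebra
      Derivation R₀ Γ(X, V α) (RingHom.ker (π α)))
    (hcompat : ∀ α β (x : ↑(pullback (e α) (e β))),
      ∃ (C C₀ : Type u) (_ : CommRing C) (_ : CommRing C₀) (_ : Algebra R₀ C) (πC : C →+* C₀)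
        (_ : RingHom.ker πC ^ 2 = ⊥) (uα : B α →ₐ[R₀] C) (uβ : B β →ₐ[R₀] C)
        (u₀α : B₀ α →+* C₀) (u₀β : B₀ β →+* C₀)
        (_ : πC.comp uα.toRingHom = u₀α.comp (π α)) (_ : πC.comp uβ.toRingHom = u₀β.comp (π β))
        (t : Spec (.of C) ⟶ pullback (e α) (e β)) (_ : IsOpenImmersion t) (_ : x ∈ Set.range t.base)
        (_ : t ≫ pullback.fst (e α) (e β) = Spec.map (CommRingCat.ofHom uα.toRingHom))
        (_ : t ≫ pullback.snd (e α) (e β) = Spec.map (CommRingCat.ofHom uβ.toRingHom))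
        (V' : X.Opens) (_ : IsAffineOpen V') (hα' : V' ≤ V α) (hβ' : V' ≤ V β)
        (Mα : Submonoid Γ(X, V α)) (Mβ : Submonoid Γ(X, V β))
        (_ : letI : Algebra Γ(X, V α) Γ(X, V') := (X.presheaf.map (homOfLE hα').op).hom.toAlgebra
          IsLocalization Mα Γ(X, V'))
        (_ : letI : Algebra Γ(X, V β) Γ(X, V') := (X.presheaf.map (homOfLE hβ').op).hom.toAlgebra
          IsLocalization Mβ Γ(X, V'))
        (hsV' : (Spec.map (CommRingCat.ofHom uα.toRingHom) ≫ (e α ≫ G)) ⁻¹ᵁ V' = ⊤),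
        letI : Algebra R₀ Γ(X, V') := ((Scheme.ΓSpecIso (.of R₀)).inv ≫ p.appLE ⊤ V' le_top).hom.toAlgebra
        letI : Algebra Γ(X, V') C := ((Spec.map (CommRingCat.ofHom uα.toRingHom) ≫ (e α ≫ G)).appLE V' ⊤
          hsV'.ge ≫ (Scheme.ΓSpecIso (.of C)).hom).hom.toAlgebra
        ∃ D' : Derivation R₀ Γ(X, V') (RingHom.ker πC),
          (∀ a : Γ(X, V α), (D' (X.presheaf.map (homOfLE hα').op a) : C) = uα (ε α a)) ∧
          (∀ b : Γ(X, V β), (D' (X.presheaf.map (homOfLE hβ').op b) : C) = uβ (ε β b))) :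
    ∃ G' : Z ⟶ X, G' ≫ p = q ∧ i ≫ G' = f₀ ∧ ∀ α, ∃ hG' : (e α ≫ G') ⁻¹ᵁ V α = ⊤,
      ∀ a, ((e α ≫ G').appLE (V α) ⊤ hG'.ge ≫ (Scheme.ΓSpecIso (.of (B α))).hom).hom a =
        ((e α ≫ G).appLE (V α) ⊤ (hG α).ge ≫ (Scheme.ΓSpecIso (.of (B α))).hom).hom a + (ε α a : B α) := by
  have w : ∀ α, (e α ≫ G) ≫ p = Spec.map (CommRingCat.ofHom (algebraMap R₀ (B α))) := fun α => by
    rw [Category.assoc, wG, hq]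
  have h₀ : ∀ α, Spec.map (CommRingCat.ofHom (π α)) ≫ (e α ≫ G) = e₀ α ≫ f₀ := fun α => by
    rw [← Category.assoc, ← hi, Category.assoc, hG₀]
  refine exists_lift_of_coboundary p q i f₀ π e e₀ V he he₀ hq hi hπ2 hV (fun α => e α ≫ G) w hG h₀ ε ?_
  intro α β x
  obtain ⟨C, C₀, _, _, _, πC, hπC2, uα, uβ, u₀α, u₀β, huα, huβ, t, ht, hx, htfst, htsnd, V', hV'a, hα', hβ', Mα,
    Mβ, hlocα, hlocβ, hsV', D', hD'α, hD'β⟩ := hcompat α β x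
  -- the two pulled-back restrictions of ONE global lift coincide on the test chart
  have est : Spec.map (CommRingCat.ofHom uα.toRingHom) ≫ (e α ≫ G) =
      Spec.map (CommRingCat.ofHom uβ.toRingHom) ≫ (e β ≫ G) := by
    rw [← htfst, ← htsnd, Category.assoc, Category.assoc, pullback.condition_assoc]
  have hsβ : (Spec.map (CommRingCat.ofHom uα.toRingHom) ≫ (e α ≫ G)) ⁻¹ᵁ V β = ⊤ := by
    rw [est]; exact preimage_specMap_comp_eq_top uβ (hG β)
  have htV' : (Spec.map (CommRingCat.ofHom uβ.toRingHom) ≫ (e β ≫ G)) ⁻¹ᵁ V' = ⊤ := by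
    rw [← est]; exact hsV'
  have htβ : (Spec.map (CommRingCat.ofHom uβ.toRingHom) ≫ (e β ≫ G)) ⁻¹ᵁ V β = ⊤ :=
    preimage_specMap_comp_eq_top uβ (hG β)
  have hagree : Spec.map (CommRingCat.ofHom πC) ≫ (Spec.map (CommRingCat.ofHom uα.toRingHom) ≫ (e α ≫ G)) =
      Spec.map (CommRingCat.ofHom πC) ≫ (Spec.map (CommRingCat.ofHom uβ.toRingHom) ≫ (e β ≫ G)) := by
    rw [est]
  refine ⟨C, C₀, inferInstance, inferInstance, inferInstance, πC, hπC2, uα, uβ, u₀α, u₀β, huα, huβ, t, ht, hx,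
    htfst, htsnd, hagree, V', hV'a, hα', hβ', Mα, Mβ, hlocα, hlocβ, hsV', hsβ, htV', htβ, D', hD'α, fun b => ?_⟩
  -- the difference term vanishes: charts of the equal morphisms `u_α^*(e α ≫ G) = u_β^*(e β ≫ G)` agree
  rw [hD'β b, congrArg (fun φ => φ.hom b) (chart_congr est hsβ htβ), sub_self, zero_add]

end Action

/-! ### §4 The difference family of two global lifts and its compatibility (the `H⁰`-torsor, transitivity) -/

section Difference

variable {X Z Z₀ : Scheme.{u}} {R₀ : Type u} [CommRing R₀] (p : X ⟶ Spec (.of R₀)) (q : Z ⟶ Spec (.of R₀))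
  (i : Z₀ ⟶ Z) (f₀ : Z₀ ⟶ X)
  {ι : Type u} {B B₀ : ι → Type u} [∀ α, CommRing (B α)] [∀ α, CommRing (B₀ α)] [∀ α, Algebra R₀ (B α)]
  (π : ∀ α, B α →+* B₀ α)
  (e : ∀ α, Spec (.of (B α)) ⟶ Z)
  (V : ι → X.Opens)

/-- **Two global lifts differ on each chart by a unique derivation** (★ `existsUnique_derivation_of_lifts` applied to
`(e α ≫ G₁, e α ≫ G₂)`): for global `S`-lifts `G₁, G₂` of `f₀` (they agree after `i`, hence after
`Spec (π α) ≫ e α = e₀ α ≫ i`) whose `α`-charts land in the affine `V α`, `ψ(e α ≫ G₂) = ψ(e α ≫ G₁) + ε α` for a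
unique `ε α ∈ Der_{R₀}(Γ(X, V α), ker (π α))`. [cite: SGA1, Exp. III §5 Prop. 5.1] -/
theorem existsUnique_derivation_of_lifts_of_cover (α : ι)
    (e₀ : Spec (.of (B₀ α)) ⟶ Z₀) (hi : e₀ ≫ i = Spec.map (CommRingCat.ofHom (π α)) ≫ e α)
    (hq : e α ≫ q = Spec.map (CommRingCat.ofHom (algebraMap R₀ (B α))))
    (hπ2 : RingHom.ker (π α) ^ 2 = ⊥) (hV : IsAffineOpen (V α))
    (G₁ G₂ : Z ⟶ X) (w₁ : G₁ ≫ p = q) (w₂ : G₂ ≫ p = q) (h₁ : i ≫ G₁ = f₀) (h₂ : i ≫ G₂ = f₀)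
    (hG₁ : (e α ≫ G₁) ⁻¹ᵁ V α = ⊤) (hG₂ : (e α ≫ G₂) ⁻¹ᵁ V α = ⊤) :
    letI : Algebra R₀ Γ(X, V α) := ((Scheme.ΓSpecIso (.of R₀)).inv ≫ p.appLE ⊤ (V α) le_top).hom.toAlgebra
    letI : Algebra Γ(X, V α) (B α) :=
      ((e α ≫ G₁).appLE (V α) ⊤ hG₁.ge ≫ (Scheme.ΓSpecIso (.of (B α))).hom).hom.toAlgebra
    ∃! ε : Derivation R₀ Γ(X, V α) (RingHom.ker (π α)), ∀ a,
      ((e α ≫ G₂).appLE (V α) ⊤ hG₂.ge ≫ (Scheme.ΓSpecIso (.of (B α))).hom).hom a =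
        ((e α ≫ G₁).appLE (V α) ⊤ hG₁.ge ≫ (Scheme.ΓSpecIso (.of (B α))).hom).hom a + (ε a : B α) := by
  have w₁' : (e α ≫ G₁) ≫ p = Spec.map (CommRingCat.ofHom (algebraMap R₀ (B α))) := by
    rw [Category.assoc, w₁, hq]
  have w₂' : (e α ≫ G₂) ≫ p = Spec.map (CommRingCat.ofHom (algebraMap R₀ (B α))) := by
    rw [Category.assoc, w₂, hq]
  have hi' : Spec.map (CommRingCat.ofHom (π α)) ≫ e α = e₀ ≫ i := hi.symm
  have h₀ : Spec.map (CommRingCat.ofHom (π α)) ≫ (e α ≫ G₁) =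
      Spec.map (CommRingCat.ofHom (π α)) ≫ (e α ≫ G₂) := by
    rw [← Category.assoc, hi', Category.assoc, h₁, ← Category.assoc, hi', Category.assoc, h₂]
  exact existsUnique_derivation_of_lifts p (π α) hV hπ2 (e α ≫ G₁) (e α ≫ G₂) w₁' w₂' h₀ hG₁ hG₂

/-- **The difference family of two global lifts is compatible on every test chart** ([SGA1, Exp. III §5 Prop. 5.1]:
the difference of two global extensions is a global section of `𝒢`, read on charts).  For global morphisms
`G₁, G₂ : Z → X` over `S` whose `α`-charts land in the affine `V α` and differ by functions `ε α : Γ(X, V α) → B α`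
(`ψ(e α ≫ G₂) = ψ(e α ≫ G₁) + ε α`; by ★ `existsUnique_derivation_of_lifts_of_cover` these are derivations into
`ker (π α)`), and ANY affine test chart `t : Spec C → Spec (B α) ×_Z Spec (B β)` (`t ≫ fst = Spec u_α`,
`t ≫ snd = Spec u_β`) with a square-zero `π_C : C → C₀` after which `G₁` and `G₂` agree, the pulled-back lift landing
in an affine `V′ ≤ V α ⊓ V β`: the `V′`-derivation `D′` of the pair `(u_α^*(e α ≫ G₁), u_α^*(e α ≫ G₂))`
(★ `existsUnique_derivation_of_lifts` in `V′`) restricts to `u_α ∘ ε α` on `Γ(X, V α)` AND to `u_β ∘ ε β` on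
`Γ(X, V β)` (★ `chart_map_apply` + ★ `charts_specMap_comp_of_derivation`, using `Spec u_α ≫ e α = Spec u_β ≫ e β`).
This is exactly the compatibility hypothesis of ★ `exists_lift_of_compatible_family`: with it, the global lifts of
`f₀` through the `V α` form a principal homogeneous space under the compatible families.
[cite: SGA1, Exp. III §5 Prop. 5.1] [cite: MumfordFogartyKirwan1994, Ch. 6 §3 Prop. 6.15 (pp. 124–125)] -/
theorem exists_restrict_eq_of_lifts_of_cover {α β : ι}
    (hq : e α ≫ q = Spec.map (CommRingCat.ofHom (algebraMap R₀ (B α)))) (hV' : ∀ γ, IsAffineOpen (V γ))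
    (G₁ G₂ : Z ⟶ X) (w₁ : G₁ ≫ p = q) (w₂ : G₂ ≫ p = q)
    (hG₁ : ∀ γ, (e γ ≫ G₁) ⁻¹ᵁ V γ = ⊤) (hG₂ : ∀ γ, (e γ ≫ G₂) ⁻¹ᵁ V γ = ⊤)
    (ε : ∀ γ, Γ(X, V γ) → B γ)
    (hε : ∀ γ a, ((e γ ≫ G₂).appLE (V γ) ⊤ (hG₂ γ).ge ≫ (Scheme.ΓSpecIso (.of (B γ))).hom).hom a =
      ((e γ ≫ G₁).appLE (V γ) ⊤ (hG₁ γ).ge ≫ (Scheme.ΓSpecIso (.of (B γ))).hom).hom a + ε γ a)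
    {C C₀ : Type u} [CommRing C] [CommRing C₀] [Algebra R₀ C] (πC : C →+* C₀) (hπC2 : RingHom.ker πC ^ 2 = ⊥)
    (uα : B α →ₐ[R₀] C) (uβ : B β →ₐ[R₀] C) (t : Spec (.of C) ⟶ pullback (e α) (e β))
    (htα : t ≫ pullback.fst (e α) (e β) = Spec.map (CommRingCat.ofHom uα.toRingHom))
    (htβ : t ≫ pullback.snd (e α) (e β) = Spec.map (CommRingCat.ofHom uβ.toRingHom))
    (hagree : Spec.map (CommRingCat.ofHom πC) ≫ (Spec.map (CommRingCat.ofHom uα.toRingHom) ≫ (e α ≫ G₁)) =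
      Spec.map (CommRingCat.ofHom πC) ≫ (Spec.map (CommRingCat.ofHom uα.toRingHom) ≫ (e α ≫ G₂)))
    (V' : X.Opens) (hV'a : IsAffineOpen V') (hα' : V' ≤ V α) (hβ' : V' ≤ V β)
    (hsV' : (Spec.map (CommRingCat.ofHom uα.toRingHom) ≫ (e α ≫ G₁)) ⁻¹ᵁ V' = ⊤)
    (hsV'₂ : (Spec.map (CommRingCat.ofHom uα.toRingHom) ≫ (e α ≫ G₂)) ⁻¹ᵁ V' = ⊤) :
    letI : Algebra R₀ Γ(X, V') := ((Scheme.ΓSpecIso (.of R₀)).inv ≫ p.appLE ⊤ V' le_top).hom.toAlgebra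
    letI : Algebra Γ(X, V') C := ((Spec.map (CommRingCat.ofHom uα.toRingHom) ≫ (e α ≫ G₁)).appLE V' ⊤
      hsV'.ge ≫ (Scheme.ΓSpecIso (.of C)).hom).hom.toAlgebra
    ∃ D' : Derivation R₀ Γ(X, V') (RingHom.ker πC),
      (∀ a : Γ(X, V α), (D' (X.presheaf.map (homOfLE hα').op a) : C) = uα (ε α a)) ∧
      (∀ b : Γ(X, V β), (D' (X.presheaf.map (homOfLE hβ').op b) : C) = uβ (ε β b)) := by
  -- the `V′`-derivation of the pair `(u_α^*(e α ≫ G₁), u_α^*(e α ≫ G₂))` (★ (ii) in `V′`)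
  have w₁' : (e α ≫ G₁) ≫ p = Spec.map (CommRingCat.ofHom (algebraMap R₀ (B α))) := by
    rw [Category.assoc, w₁, hq]
  have w₂' : (e α ≫ G₂) ≫ p = Spec.map (CommRingCat.ofHom (algebraMap R₀ (B α))) := by
    rw [Category.assoc, w₂, hq]
  have ws₁ := specMap_comp_over p uα (e α ≫ G₁) w₁'
  have ws₂ := specMap_comp_over p uα (e α ≫ G₂) w₂'
  obtain ⟨D', hD', -⟩ := existsUnique_derivation_of_lifts p πC hV'a hπC2 _ _ ws₁ ws₂ hagree hsV' hsV'₂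
  -- the two pulled-back restrictions of each global lift coincide on the test chart
  have est : ∀ G : Z ⟶ X, Spec.map (CommRingCat.ofHom uα.toRingHom) ≫ (e α ≫ G) =
      Spec.map (CommRingCat.ofHom uβ.toRingHom) ≫ (e β ≫ G) := fun G => by
    rw [← htα, ← htβ, Category.assoc, Category.assoc, pullback.condition_assoc]
  refine ⟨D', fun a => ?_, fun b => ?_⟩
  · -- read in `V α`: `D′(a|) = ψ_{V α}(u_α^*(e α ≫ G₂)) a − ψ_{V α}(u_α^*(e α ≫ G₁)) a = u_α (ε α a)`
    have hs₁α := preimage_specMap_comp_eq_top uα (hG₁ α)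
    have hs₂α := preimage_specMap_comp_eq_top uα (hG₂ α)
    have hd := hD' (X.presheaf.map (homOfLE hα').op a)
    rw [chart_map_apply hα' _ hs₂α hsV'₂ a, chart_map_apply hα' _ hs₁α hsV' a,
      charts_specMap_comp_of_derivation uα (hV' α) (hG₁ α) (hG₂ α) hs₁α hs₂α (hε α) a] at hd
    exact (add_left_cancel hd).symm
  · -- read in `V β` after transporting along `u_α^*(e α ≫ Gᵢ) = u_β^*(e β ≫ Gᵢ)`
    have hs₁β := preimage_specMap_comp_eq_top uβ (hG₁ β)
    have hs₂β := preimage_specMap_comp_eq_top uβ (hG₂ β)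
    have hs₁V' : (Spec.map (CommRingCat.ofHom uβ.toRingHom) ≫ (e β ≫ G₁)) ⁻¹ᵁ V' = ⊤ := by
      rw [← est]; exact hsV'
    have hs₂V' : (Spec.map (CommRingCat.ofHom uβ.toRingHom) ≫ (e β ≫ G₂)) ⁻¹ᵁ V' = ⊤ := by
      rw [← est]; exact hsV'₂
    have hd := hD' (X.presheaf.map (homOfLE hβ').op b)
    rw [congrArg (fun φ => φ.hom (X.presheaf.map (homOfLE hβ').op b)) (chart_congr (est G₂) hsV'₂ hs₂V'),
      congrArg (fun φ => φ.hom (X.presheaf.map (homOfLE hβ').op b)) (chart_congr (est G₁) hsV' hs₁V'),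
      chart_map_apply hβ' _ hs₂β hs₂V' b, chart_map_apply hβ' _ hs₁β hs₁V' b,
      charts_specMap_comp_of_derivation uβ (hV' β) (hG₁ β) (hG₂ β) hs₁β hs₂β (hε β) b] at hd
    exact (add_left_cancel hd).symm

end Difference

end Literature.AlgebraicGeometry.Deformation

end
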